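/-
Origin: expansion seat `planner-pub-hodgecm-pv05-0`, handover v4 2026-08-18T04:03:00Z (`HOME/pub-hodgecm-pv05/lean/Pv05/DoublingBridge.lean`, md5 1c091bca, 233 lines);
landed by the gen-5 packager in gate run 20 as `HodgeCM/PerL34/DoublingBridge.lean` (verbatim).
-/
/-
pub-hodgecm speedrun cell, prover pv05 — WIP module `Pv05.DoublingBridge` (proposed landing place
`HodgeCM/PerL34/DoublingBridge.lean`, namespace `HodgeCM.PerL34.Doubling.DoublingDatum`).
Imports: the three LANDED sibling files of the N31 cluster (runs 18/19). Nothing posited, nothing cited: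
pure glue between already-landed declarations (referee 2, G-R2-11: close cluster edges BY NAME).

# The N31b → N31c → N31e seam of Lemma 4.2(b), by name

* N31b (pv05, `HodgeCM.PerL34.Doubling`): the posited adelic doubling DATA `DoublingDatum A H S Sbox`
  with its two GQT §11.3 hypothesis fields `equivariant` (PRINT-DERIVED) and `ev0_δ` (PRINT).
* N31c (pv11, `HodgeCM.PerL34.EqBasic`): (eq:basic), tex l. 566, stated over UNBUNDLED hypotheses of the
  same shapes, with `χ_V : A →* Circle`.
* (4) below (v3): the N31d → N31e seam with the Eisenstein series TYPED AS ITS SERIES (`RallisIP.eisSeries`,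
  `N31e_of_doublingDatum_series`): pv09's opaque `hEis` becomes the print input "the series is summable";
  (5) (v4): `hPinv` ⇐ `ev0`-invariance under the rational Siegel parabolic (`hPinv_of_ev0`), and the fully
  labelled `N31e_of_doublingDatum_final` (inputs: `hev0`, `hsum`, `hK`, `hint` + arithmetic set-up).
* N31e (pv09, `HodgeCM.PerL34.RallisIP`): Rallis' inner product formula `N31e_holds`, whose hypothesis
  `hbasic : ∀ h₁ h₂, fbox (ι (h₁, h₂)) = χV h₂ * inner ℂ (ω h₂ φ) (ω h₁ φ)` is "(N31c) … its output verbatim".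

COORDINATION (v2): pv11's `EqBasicDatum.lean` (handed over 03:47Z, same namespace) owns the by-name statement
`DoublingDatum.eq_basic` (+ `fSW_Φ_ι`, `eq_basic_diag`, `fSW_Φ_one`, `fSW_eq_unbundled`, `Φ_eq_unbundled`);
this file defines NONE of those names and does not depend on that file, so the two land in either order.

This file proves: (1) `DoublingDatum.χVc` — `χ_V` repackaged as a `Circle`-valued character — and
`eq_basic_circle` — pv11's run-18 theorem `EqBasic.eq_basic` APPLIED to a doubling datum (its two
hypotheses are the datum's two fields; `EqBasic.fSW D.ωbox D.ev0 = D.fSW` and `EqBasic.PhiOf D.δ = D.Φ`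
hold definitionally), giving (eq:basic) with Mathlib's `inner`; (2) `DoublingDatum.hbasic` — exactly the
`hbasic` hypothesis of `RallisIP.N31e_holds` for `fbox := f_{δ(φ ⊗ φ̄)}(·, s₀) = D.fSW (D.Φ φ)`, proved
directly from `fSW_ι_mul`/`fSW_one` (tex l. 566 read with `⟨a,b⟩ = ⟪b,a⟫_ℂ`); (3) `N31e_of_doublingDatum`
— `RallisIP.N31e_holds` with `ι, ω, χ_V, fbox, hbasic` supplied by the datum: the remaining hypotheses
are pv09's N31d inputs (`hPinv`, `hEis`, `hK`), the N31f integrability `hint`, and the arithmetic set-up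
(rational points, fundamental domain, automorphy of `χ'`, `χ_V(δ') = 1`).
-/
import Summits.HodgeConjecture.HodgeCM.PerL34.Doubling_2
import Summits.HodgeConjecture.HodgeCM.PerL34.EqBasic
import Summits.HodgeConjecture.HodgeCM.PerL34.RallisIP

set_option autoImplicit false

noncomputable section

open MeasureTheory Complex ComplexConjugate

namespace HodgeCM
namespace PerL34
namespace Doubling
namespace DoublingDatum

variable {A H S Sbox : Type*} [CommGroup A] [Group H]
  [NormedAddCommGroup S] [InnerProductSpace ℂ S] [AddCommGroup Sbox] [Module ℂ Sbox]
  (D : DoublingDatum A H S Sbox)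

/-! ## (1) pv11's unbundled `EqBasic.eq_basic` (node N31c, run 18) applies to the datum -/

/-- `χ_V` as a `Circle`-valued character (pv11's typing of the unitary Hecke character). -/
def χVc : A →* Circle where
  toFun a := ⟨D.χV a, by simp [Submonoid.unitSphere, D.norm_χV a]⟩
  map_one' := Subtype.ext (by simp)
  map_mul' a b := Subtype.ext (by simp)

/-- (Ported verbatim from the HodgeCMPerL package; no docstring in the source.) -/
@[simp] theorem coe_χVc (a : A) : ((D.χVc a : Circle) : ℂ) = D.χV a := rfl

/-- The two hypotheses of `EqBasic.eq_basic` are the two fields of the datum, so pv11's theorem applies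
to every doubling datum (the left-hand side `EqBasic.fSW D.ωbox D.ev0 (EqBasic.PhiOf D.δ φ)` is
`D.fSW (D.Φ φ)` by `rfl`): (eq:basic), tex l. 566, with Mathlib's `inner` and `χ_V` through `Circle`. -/
theorem eq_basic_circle (φ : S) (h₁ h₂ : A) :
    D.fSW (D.Φ φ) (D.ι (h₁, h₂)) = (D.χVc h₂ : ℂ) * inner ℂ (D.ω h₂ φ) (D.ω h₁ φ) :=
  EqBasic.eq_basic D.ι D.ω D.ωbox D.ev0 D.χVc D.δ
    (fun h₁ h₂ φ₁ φ₂ => by rw [coe_χVc]; exact D.equivariant h₁ h₂ φ₁ φ₂)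
    (fun φ₁ φ₂ => by rw [D.ev0_δ, pair_def])
    φ h₁ h₂

/-! ## (2) The `hbasic` hypothesis of pv09's `RallisIP.N31e_holds` (node N31e) -/

/-- Exactly the hypothesis `hbasic` of `RallisIP.N31e_holds`, for `fbox := D.fSW (D.Φ φ)`. -/
theorem hbasic (φ : S) :
    ∀ h₁ h₂ : A, D.fSW (D.Φ φ) (D.ι (h₁, h₂)) = D.χV h₂ * inner ℂ (D.ω h₂ φ) (D.ω h₁ φ) := by
  intro h₁ h₂
  have key := D.fSW_ι_mul h₁ h₂ φ φ 1
  rw [one_mul] at key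
  rw [Φ_def, key, fSW_one, pair_def]

/-! ## (3) N31e with the doubling datum plugged in -/

open RallisIP in
/-- **N31e from a doubling datum**: `RallisIP.N31e_holds` (pv09) with `ι, ω, χ_V` the datum's and the
(eq:basic) hypothesis DISCHARGED by `hbasic`; every remaining hypothesis is pv09's, verbatim (N31d: `hPinv`,
`hEis`, `hK`; N31f: `hint`; arithmetic set-up: `jA`, `j`, `hj`, `h𝓕`, `hχ'`, `hχVΓ`). -/
theorem N31e_of_doublingDatum
    {L : Type*} [Field L] [StarRing L] {W : Type*} [AddCommGroup W] [Module L W]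
    {h : W →ₗ⋆[L] W →ₗ[L] L} (hW : IsLine L W) (hh : Anisotropic h)
    [MeasurableSpace A] [MeasurableMul₂ A] [MeasurableInv A] (μ : Measure A) [μ.IsMulLeftInvariant]
    [μ.IsInvInvariant]
    [Countable (unitary L)] (jA : unitary L →* A) (hjA : Function.Injective jA)
    (j : isomBox h →* H) (hj : ∀ d : unitary L, j ⟨iotaSnd d, iotaSnd_mem h d⟩ = D.ι (1, jA d))
    {𝓕 : Set A} (h𝓕 : IsFundamentalDomain jA.range 𝓕 μ)
    (χ' : A → ℂ) (hχ' : IsAutChar jA.range χ') (hχ'm : Measurable χ')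
    (hχVΓ : ∀ d : unitary L, D.χV (jA d) = 1)
    (φ : S) (E : H → ℂ) (K : A → A → ℂ) (c : ℂ)
    (hPinv : ∀ p ∈ (stabDelta L W).subgroupOf (isomBox h), ∀ x : H,
      D.fSW (D.Φ φ) (j p * x) = D.fSW (D.Φ φ) x)
    (hEis : ∀ u u' : A, HasSum (eisTerm h j (D.fSW (D.Φ φ)) hPinv (D.ι (u, u'))) (E (D.ι (u, u'))))
    (hK : ∀ u u' : A, K u u' = c * (D.χV u')⁻¹ * E (D.ι (u, u')))
    (hint : Integrable (fun y => inner ℂ φ (D.ω y φ)) μ) :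
    N31e_statement μ 𝓕 D.ω φ χ' K c :=
  N31e_holds hW hh μ D.ι D.ω D.χV D.norm_χV jA hjA j hj h𝓕 χ' hχ' hχ'm hχVΓ φ (D.fSW (D.Φ φ)) E K c
    (D.hbasic φ) hPinv hEis hK hint

end DoublingDatum
end Doubling

/-! ## (4) The N31d → N31e seam typed: the Eisenstein series AS ITS SERIES (GAPS pv05-X1, seam (E))

pv15's `SiegelWeil.DoublingKernelData.E` is an opaque function and its absolute-convergence field is
`E_absConv : True`; pv09's `N31e_holds` needs `hEis : HasSum (eisTerm …) (E (ι(u,u')))`, i.e. that `E` IS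
the sum of its defining series `Σ_{γ ∈ P(L₀)\H(L₀)} f_Φ(γh, s₀)` (tex l. 573–574).  The honest typed
form of the print input is therefore **summability of the Eisenstein series** — for `ℂ`-valued families
Mathlib's `Summable` is unconditional = absolute convergence (`summable_norm_iff` in finite dimension),
which is [We65] n°38 condition (B) "m > 2n + 4ε − 2" at s₀ (l. 574–575) — and then `E` is DEFINED as the
`tsum`, so `hEis` holds by `Summable.hasSum` and the Siegel–Weil identity `hK` is stated for this `E`. -/

namespace RallisIP

variable {L : Type*} [Field L] [StarRing L] {W : Type*} [AddCommGroup W] [Module L W] {H : Type*} [Group H]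

/-- `E(x, s₀; f) := Σ'_{P(L₀)γ ∈ P(L₀)\H(L₀)} f(γx)` — the Eisenstein series defined as its (unconditional)
sum (tex l. 573–574); meaningful when the series is summable, junk `0` otherwise. -/
noncomputable def eisSeries (h : W →ₗ⋆[L] W →ₗ[L] L) (j : isomBox h →* H) (fbox : H → ℂ)
    (hPinv : ∀ p ∈ (stabDelta L W).subgroupOf (isomBox h), ∀ x : H,
      fbox (j p * x) = fbox x) (x : H) : ℂ :=
  ∑' q, eisTerm h j fbox hPinv x q

/-- (Ported verbatim from the HodgeCMPerL package; no docstring in the source.) -/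
theorem hasSum_eisSeries {h : W →ₗ⋆[L] W →ₗ[L] L} {j : isomBox h →* H} {fbox : H → ℂ}
    {hPinv : ∀ p ∈ (stabDelta L W).subgroupOf (isomBox h), ∀ x : H,
      fbox (j p * x) = fbox x} {x : H} (hsum : Summable (eisTerm h j fbox hPinv x)) :
    HasSum (eisTerm h j fbox hPinv x) (eisSeries h j fbox hPinv x) :=
  hsum.hasSum

/-- Absolute convergence is the same hypothesis: for `ℂ`-valued families `Summable f ↔ Summable ‖f‖`. -/
theorem summable_eisTerm_iff_abs {h : W →ₗ⋆[L] W →ₗ[L] L} {j : isomBox h →* H} {fbox : H → ℂ}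
    {hPinv : ∀ p ∈ (stabDelta L W).subgroupOf (isomBox h), ∀ x : H,
      fbox (j p * x) = fbox x} {x : H} :
    Summable (eisTerm h j fbox hPinv x) ↔ Summable (fun q => ‖eisTerm h j fbox hPinv x q‖) :=
  summable_norm_iff.symm

end RallisIP

namespace Doubling.DoublingDatum

variable {A H S Sbox : Type*} [CommGroup A] [Group H]
  [NormedAddCommGroup S] [InnerProductSpace ℂ S] [AddCommGroup Sbox] [Module ℂ Sbox]
  (D : DoublingDatum A H S Sbox)

open RallisIP in
/-- **N31e from a doubling datum, the Eisenstein series typed as a series**: as `N31e_of_doublingDatum`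
but with `E := eisSeries h j f_Φ hPinv` and the print input carried as SUMMABILITY `hsum` of the series at
the points `ι(u,u')` ([We65] n°38 (B) at s₀, tex l. 573–575) instead of the opaque `hEis`; the Siegel–Weil
identity `hK` (pv15's X₁, [GQT] Thm 7.1 / [We65] Thm 5, l. 580–581) is stated for THIS `E`.  Remaining
labelled inputs: `hPinv` (f_Φ(·,s₀) left `P(L₀)`-invariant, l. 572: the Siegel-parabolic action formula of
the Weil representation + automorphy of χ_V — PRINT, not typed here), `hsum`, `hK`, `hint` (N31f). -/
theorem N31e_of_doublingDatum_series
    {L : Type*} [Field L] [StarRing L] {W : Type*} [AddCommGroup W] [Module L W]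
    {h : W →ₗ⋆[L] W →ₗ[L] L} (hW : IsLine L W) (hh : Anisotropic h)
    [MeasurableSpace A] [MeasurableMul₂ A] [MeasurableInv A] (μ : Measure A) [μ.IsMulLeftInvariant]
    [μ.IsInvInvariant]
    [Countable (unitary L)] (jA : unitary L →* A) (hjA : Function.Injective jA)
    (j : isomBox h →* H) (hj : ∀ d : unitary L, j ⟨iotaSnd d, iotaSnd_mem h d⟩ = D.ι (1, jA d))
    {𝓕 : Set A} (h𝓕 : IsFundamentalDomain jA.range 𝓕 μ)
    (χ' : A → ℂ) (hχ' : IsAutChar jA.range χ') (hχ'm : Measurable χ')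
    (hχVΓ : ∀ d : unitary L, D.χV (jA d) = 1)
    (φ : S) (K : A → A → ℂ) (c : ℂ)
    (hPinv : ∀ p ∈ (stabDelta L W).subgroupOf (isomBox h), ∀ x : H,
      D.fSW (D.Φ φ) (j p * x) = D.fSW (D.Φ φ) x)
    (hsum : ∀ u u' : A, Summable (eisTerm h j (D.fSW (D.Φ φ)) hPinv (D.ι (u, u'))))
    (hK : ∀ u u' : A, K u u' = c * (D.χV u')⁻¹ * eisSeries h j (D.fSW (D.Φ φ)) hPinv (D.ι (u, u')))
    (hint : Integrable (fun y => inner ℂ φ (D.ω y φ)) μ) :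
    N31e_statement μ 𝓕 D.ω φ χ' K c :=
  D.N31e_of_doublingDatum hW hh μ jA hjA j hj h𝓕 χ' hχ' hχ'm hχVΓ φ (eisSeries h j (D.fSW (D.Φ φ)) hPinv)
    K c hPinv (fun u u' => hasSum_eisSeries (hsum u u')) hK hint

/-! ## (5) `hPinv` reduced to its print shape: the functional `Φ ↦ Φ(0)` is `P(L₀)`-invariant

`f_Φ(x) = (ω^□(x)Φ)(0)`, so left invariance of `f_Φ` under a set of elements `p` (tex l. 572: f_Φ ∈ the
induced space, in particular left `P(L₀)`-invariant) is EXACTLY invariance of the evaluation functional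
`ev0` under `ω^□(p)`.  For the rational Siegel parabolic this is the print input "(ω^□(m(a)n(b))Φ)(0) =
χ_V(det a)|det a|^{3/2}Φ(0)" (the Schrödinger-model formulas of the Weil representation on the Siegel
parabolic) + "χ_V(det a) = 1, |det a|_𝔸 = 1 for a rational" (automorphy of χ_V, product formula) — carried
below as the hypothesis `hev0`, not asserted. -/

/-- Left invariance of every `f_Ψ` under `p` from invariance of `ev0` under `ω^□(p)`. -/
theorem fSW_left_invariant {p : H} (hev0 : ∀ Ψ' : Sbox, D.ev0 (D.ωbox p Ψ') = D.ev0 Ψ') (Ψ : Sbox)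
    (x : H) : D.fSW Ψ (p * x) = D.fSW Ψ x := by
  rw [fSW_def, fSW_def, map_mul, LinearEquiv.mul_apply, hev0]

open RallisIP in
/-- The `hPinv` hypothesis of `N31e_holds` / `N31e_of_doublingDatum(_series)` from `ev0`-invariance under
the rational Siegel parabolic `j(P(L₀))`. -/
theorem hPinv_of_ev0 {L : Type*} [Field L] [StarRing L] {W : Type*} [AddCommGroup W] [Module L W]
    {h : W →ₗ⋆[L] W →ₗ[L] L} (j : isomBox h →* H)
    (hev0 : ∀ p ∈ (stabDelta L W).subgroupOf (isomBox h), ∀ Ψ' : Sbox, D.ev0 (D.ωbox (j p) Ψ') = D.ev0 Ψ')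
    (Ψ : Sbox) : ∀ p ∈ (stabDelta L W).subgroupOf (isomBox h), ∀ x : H, D.fSW Ψ (j p * x) = D.fSW Ψ x :=
  fun p hp x => D.fSW_left_invariant (hev0 p hp) Ψ x

open RallisIP in
/-- **N31e from a doubling datum — final labelled form**: inputs `hev0` (PRINT shape, (5)), `hsum`
(PRINT [We65] (B), (4)), `hK` (PRINT [GQT] Thm 7.1 via pv15's X₁, for `E := eisSeries`), `hint` (N31f),
and pv09's arithmetic set-up; (eq:basic), `hbasic`, `hPinv`, `hEis` are all DISCHARGED by name. -/
theorem N31e_of_doublingDatum_final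
    {L : Type*} [Field L] [StarRing L] {W : Type*} [AddCommGroup W] [Module L W]
    {h : W →ₗ⋆[L] W →ₗ[L] L} (hW : IsLine L W) (hh : Anisotropic h)
    [MeasurableSpace A] [MeasurableMul₂ A] [MeasurableInv A] (μ : Measure A) [μ.IsMulLeftInvariant]
    [μ.IsInvInvariant]
    [Countable (unitary L)] (jA : unitary L →* A) (hjA : Function.Injective jA)
    (j : isomBox h →* H) (hj : ∀ d : unitary L, j ⟨iotaSnd d, iotaSnd_mem h d⟩ = D.ι (1, jA d))
    {𝓕 : Set A} (h𝓕 : IsFundamentalDomain jA.range 𝓕 μ)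
    (χ' : A → ℂ) (hχ' : IsAutChar jA.range χ') (hχ'm : Measurable χ')
    (hχVΓ : ∀ d : unitary L, D.χV (jA d) = 1)
    (φ : S) (K : A → A → ℂ) (c : ℂ)
    (hev0 : ∀ p ∈ (stabDelta L W).subgroupOf (isomBox h), ∀ Ψ' : Sbox, D.ev0 (D.ωbox (j p) Ψ') = D.ev0 Ψ')
    (hsum : ∀ u u' : A,
      Summable (eisTerm h j (D.fSW (D.Φ φ)) (D.hPinv_of_ev0 j hev0 (D.Φ φ)) (D.ι (u, u'))))
    (hK : ∀ u u' : A, K u u'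
      = c * (D.χV u')⁻¹ * eisSeries h j (D.fSW (D.Φ φ)) (D.hPinv_of_ev0 j hev0 (D.Φ φ)) (D.ι (u, u')))
    (hint : Integrable (fun y => inner ℂ φ (D.ω y φ)) μ) :
    N31e_statement μ 𝓕 D.ω φ χ' K c :=
  D.N31e_of_doublingDatum_series hW hh μ jA hjA j hj h𝓕 χ' hχ' hχ'm hχVΓ φ K c
    (D.hPinv_of_ev0 j hev0 (D.Φ φ)) hsum hK hint

end Doubling.DoublingDatum
end PerL34
end HodgeCM

end
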